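import Mathlib
import HarnessLib
import Summits.HubbardSuperconductivity.HubbardSuperconductivity.Theorems.KLProgrammeLatticePlanarRiemann
import Summits.HubbardSuperconductivity.HubbardSuperconductivity.Theorems.KLProgrammeMatsubaraSliceBubbleTransfer
import Literature.MathematicalPhysics.QuantumLattice.HubbardSectorPhaseSpaceCount

/-!
# Route `KLProgramme` — crux K3, ENGINE child (stmt-HubbardSuperconductivity-19855 `KLRegimeEngineV12`): a Matsubara-summed LATTICE bubble is bounded by its
# planar (ℝ × ℝ) estimate plus `32Λ_n·K/L` (cell gate-hubbard-kl, seat hubbard-kl-k3c2-p2)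

The composition step that carries every `ℝ × ℝ`-stated bubble bound of this lane (`klfb_planar_*`, `klfs_planar_*`, `klfp_planar_*`: bounds `B` on
`‖β⁻¹•Σ_i ∫_{ℝ²} h_i‖`) to the MODEL carrier `MatsubaraIdx M × TorusSite 2 L`: if the model's per-frequency integrand `F_i` (continuous, doubly
`2π`-periodic, `K`-Lipschitz in the sup metric) agrees with `h_i` on the closed square, `h_i` vanishes off it, and `F_i ≡ 0` for `|ω_i| ≥ r` (slice
support in the frequency), then
`‖β⁻¹•Σ_i L⁻²•Σ_k F_i(2πk/L)‖ ≤ B/(2π)² + (r/π + 3/β)·2πK/L` (`klfl_matsubara_latticeAverage_norm_le`; `card_filter_matsubaraFreq_le`), and in scale form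
(`r = 4Λ_n`, `n ≤ n_β + 1`, `β ≥ klBetaMin`, `klsp_count_factor_le`) `≤ B/(2π)² + 32Λ_n·K/L` (`klfl_matsubara_latticeAverage_norm_le_scale`) — the `Q.CL β n/L` line
of `eremBar`.  Pure analysis; nothing about the model is asserted.
-/

noncomputable section

namespace Summit.HubbardSuperconductivity.HubbardSuperconductivity.Theorems.KLRegimeSplit

set_option linter.dupNamespace false -- summit = problem name (single-conjunct summit), D-0017

open Real Set MeasureTheory Literature.Probability.LatticeModels Literature.MathematicalPhysics.QuantumLattice
open Summit.HubbardSuperconductivity.HubbardSuperconductivity.Theorems.KLProgrammeLegKernels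
open scoped NNReal

variable {E : Type*} [NormedAddCommGroup E] [NormedSpace ℝ E] [CompleteSpace E]

/-- **A Matsubara-summed lattice bubble against its planar estimate.**  `F_i, h_i : ℝ × ℝ → E` (`i : MatsubaraIdx M`): each `F_i` continuous, doubly
`2π`-periodic, `K`-Lipschitz (sup metric), `= h_i` on the closed square, `h_i = 0` off it, and `F_i ≡ 0` whenever `|ω_i| ≥ r` (`r ≥ 0`, `β > 0`).  If
`‖β⁻¹•Σ_i ∫ h_i‖ ≤ B` then `‖β⁻¹•Σ_i L⁻²•Σ_k F_i(2πk₀/L, 2πk₁/L)‖ ≤ B/(2π)² + (r/π + 3/β)·(2πK/L)`. -/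
theorem klfl_matsubara_latticeAverage_norm_le {M : ℕ} {F h : MatsubaraIdx M → ℝ × ℝ → E} {K : ℝ≥0} {B r β : ℝ} (hβ : 0 < β) (hr : 0 ≤ r)
    (hF : ∀ i, Continuous (F i)) (h1 : ∀ i x y, F i (x + 2 * π, y) = F i (x, y)) (h2 : ∀ i x y, F i (x, y + 2 * π) = F i (x, y))
    (hlip : ∀ i (p q : ℝ × ℝ), ‖F i p - F i q‖ ≤ K * dist p q)
    (hFh : ∀ i, ∀ p ∈ Icc (-π) π ×ˢ Icc (-π) π, F i p = h i p) (hh0 : ∀ i, ∀ p ∉ Icc (-π) π ×ˢ Icc (-π) π, h i p = 0)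
    (hzero : ∀ i, r ≤ |matsubaraFreq β M i| → ∀ p, F i p = 0)
    (hB : ‖β⁻¹ • ∑ i : MatsubaraIdx M, ∫ p, h i p‖ ≤ B) (L : ℕ) [NeZero L] :
    ‖β⁻¹ • ∑ i : MatsubaraIdx M,
        ((L ^ 2 : ℕ) : ℝ)⁻¹ • ∑ k : TorusSite 2 L, F i (latticeMomentum L k 0, latticeMomentum L k 1)‖ ≤
      ((2 * π) ^ 2)⁻¹ * B + (r / π + 3 / β) * (2 * π * K / L) := by
  have hL : (0 : ℝ) < L := by exact_mod_cast Nat.pos_of_ne_zero (NeZero.ne L)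
  set ω : MatsubaraIdx M → ℝ := fun i => matsubaraFreq β M i with hω
  set a : MatsubaraIdx M → E := fun i =>
    ((L ^ 2 : ℕ) : ℝ)⁻¹ • ∑ k : TorusSite 2 L, F i (latticeMomentum L k 0, latticeMomentum L k 1) with ha
  set b : MatsubaraIdx M → E := fun i => ((2 * π) ^ 2)⁻¹ • ∫ p, h i p with hb
  -- per frequency: `‖a_i − b_i‖ ≤ 2πK/L`, and `= 0` off the frequency support
  have hdiff : ∀ i, ‖a i - b i‖ ≤ if |ω i| < r then 2 * π * K / L else 0 := by
    intro i
    split_ifs with hi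
    · exact klfl_latticeAverage_sub_planar_integral_norm_le (hF i) (h1 i) (h2 i) (hlip i) (hFh i) (hh0 i) L
    · have hFi : ∀ p, F i p = 0 := hzero i (not_lt.mp hi)
      have hhi : ∀ p, h i p = 0 := by
        intro p
        by_cases hp : p ∈ Icc (-π) π ×ˢ Icc (-π) π
        · rw [← hFh i p hp, hFi]
        · exact hh0 i p hp
      simp only [ha, hb, hFi, hhi, Finset.sum_const_zero, smul_zero, integral_zero, sub_self, norm_zero, le_refl]
  have hcard := card_filter_matsubaraFreq_le hβ hr (Finset.univ.filter fun i : MatsubaraIdx M => |ω i| < r)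
    (fun i hi => ((Finset.mem_filter.mp hi).2).le)
  have hsum : ∑ i : MatsubaraIdx M, (if |ω i| < r then 2 * π * K / L else 0) =
      ((Finset.univ.filter fun i : MatsubaraIdx M => |ω i| < r).card : ℝ) * (2 * π * K / L) := by
    rw [Finset.sum_ite, Finset.sum_const_zero, add_zero, Finset.sum_const, nsmul_eq_mul]
  -- split `a = b + (a − b)`
  have e1 : ((2 * π) ^ 2)⁻¹ • (β⁻¹ • ∑ i : MatsubaraIdx M, ∫ p, h i p) = β⁻¹ • ∑ i, b i := by
    rw [smul_comm, Finset.smul_sum]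
  have hsplit : (β⁻¹ • ∑ i, a i) = ((2 * π) ^ 2)⁻¹ • (β⁻¹ • ∑ i : MatsubaraIdx M, ∫ p, h i p) + β⁻¹ • ∑ i, (a i - b i) := by
    rw [e1, ← smul_add, ← Finset.sum_add_distrib]
    congr 1
    exact Finset.sum_congr rfl fun i _ => by abel
  have hK0 : 0 ≤ 2 * π * (K : ℝ) / L := by positivity
  calc ‖β⁻¹ • ∑ i, a i‖
      = ‖((2 * π) ^ 2)⁻¹ • (β⁻¹ • ∑ i : MatsubaraIdx M, ∫ p, h i p) + β⁻¹ • ∑ i, (a i - b i)‖ := by rw [hsplit]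
    _ ≤ ‖((2 * π) ^ 2)⁻¹ • (β⁻¹ • ∑ i : MatsubaraIdx M, ∫ p, h i p)‖ + ‖β⁻¹ • ∑ i, (a i - b i)‖ := norm_add_le _ _
    _ ≤ ((2 * π) ^ 2)⁻¹ * B + β⁻¹ * ∑ i, ‖a i - b i‖ := by
        refine add_le_add ?_ ?_
        · rw [norm_smul, norm_inv, norm_pow, Real.norm_of_nonneg (by positivity : (0:ℝ) ≤ 2 * π)]
          exact mul_le_mul_of_nonneg_left hB (by positivity)
        · rw [norm_smul, norm_inv, Real.norm_of_nonneg hβ.le]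
          exact mul_le_mul_of_nonneg_left (norm_sum_le _ _) (inv_nonneg.mpr hβ.le)
    _ ≤ ((2 * π) ^ 2)⁻¹ * B + β⁻¹ * (((Finset.univ.filter fun i : MatsubaraIdx M => |ω i| < r).card : ℝ) * (2 * π * K / L)) := by
        rw [← hsum]
        exact add_le_add le_rfl (mul_le_mul_of_nonneg_left (Finset.sum_le_sum fun i _ => hdiff i) (inv_nonneg.mpr hβ.le))
    _ ≤ ((2 * π) ^ 2)⁻¹ * B + β⁻¹ * ((r * β / π + 3) * (2 * π * K / L)) :=
        add_le_add le_rfl (mul_le_mul_of_nonneg_left (mul_le_mul_of_nonneg_right hcard hK0) (inv_nonneg.mpr hβ.le))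
    _ = ((2 * π) ^ 2)⁻¹ * B + (r / π + 3 / β) * (2 * π * K / L) := by field_simp

/-- **Scale form**: with the slice frequency support `r = 4Λ_n`, `n ≤ n_β + 1`, `β ≥ klBetaMin`:
`‖β⁻¹•Σ_i L⁻²•Σ_k F_i(2πk/L)‖ ≤ B/(2π)² + 32·Λ_n·K/L` — the finite-volume line of the remainder budget. -/
theorem klfl_matsubara_latticeAverage_norm_le_scale {M : ℕ} {F h : MatsubaraIdx M → ℝ × ℝ → E} {K : ℝ≥0} {B β : ℝ}
    (hβ : klBetaMin ≤ β) {n : ℕ} (hn : n ≤ nScales β + 1)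
    (hF : ∀ i, Continuous (F i)) (h1 : ∀ i x y, F i (x + 2 * π, y) = F i (x, y)) (h2 : ∀ i x y, F i (x, y + 2 * π) = F i (x, y))
    (hlip : ∀ i (p q : ℝ × ℝ), ‖F i p - F i q‖ ≤ K * dist p q)
    (hFh : ∀ i, ∀ p ∈ Icc (-π) π ×ˢ Icc (-π) π, F i p = h i p) (hh0 : ∀ i, ∀ p ∉ Icc (-π) π ×ˢ Icc (-π) π, h i p = 0)
    (hzero : ∀ i, 4 * klScale klE0 n ≤ |matsubaraFreq β M i| → ∀ p, F i p = 0)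
    (hB : ‖β⁻¹ • ∑ i : MatsubaraIdx M, ∫ p, h i p‖ ≤ B) (L : ℕ) [NeZero L] :
    ‖β⁻¹ • ∑ i : MatsubaraIdx M,
        ((L ^ 2 : ℕ) : ℝ)⁻¹ • ∑ k : TorusSite 2 L, F i (latticeMomentum L k 0, latticeMomentum L k 1)‖ ≤
      ((2 * π) ^ 2)⁻¹ * B + 32 * klScale klE0 n * K / L := by
  have hβ0 : 0 < β := pos_of_klBetaMin_le hβ
  have hΛ := klth_klScale_pos n
  have hL : (0 : ℝ) < L := by exact_mod_cast Nat.pos_of_ne_zero (NeZero.ne L)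
  have h := klfl_matsubara_latticeAverage_norm_le hβ0 (by positivity : (0:ℝ) ≤ 4 * klScale klE0 n) hF h1 h2 hlip hFh hh0 hzero hB L
  refine h.trans (add_le_add le_rfl ?_)
  have hcount := klsp_count_factor_le hβ hn
  have hK0 : 0 ≤ 2 * π * (K : ℝ) / L := by positivity
  calc (4 * klScale klE0 n / π + 3 / β) * (2 * π * K / L) ≤ (16 / π * klScale klE0 n) * (2 * π * K / L) :=
        mul_le_mul_of_nonneg_right hcount hK0
    _ = 32 * klScale klE0 n * K / L := by field_simp; ring

end Summit.HubbardSuperconductivity.HubbardSuperconductivity.Theorems.KLRegimeSplit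

end
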